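import Literature.Probability.RandomPlanarGeometry.HexSAWRotSurfaceYcFaces
import Literature.Probability.RandomPlanarGeometry.HexSAWSurfaceYcCut
import HarnessLib

/-!
# Beaton's rotated-frame critical surface fugacity, II: the two-cut decomposition of rotated half-plane walks
# (door (c-rot-print) «HEX-YC-ROT-PRINT», tree edition file R2 of 3 — face D1ʳ `RotHalfPlaneCut`; frame twin of `HexSAWSurfaceYcCut.lean`)

Topic `Literature/Probability/RandomPlanarGeometry` (continues `HexSAWRotSurfaceYcFaces.lean`).
Sources: N. R. Beaton, *The critical surface fugacity of self-avoiding walks on a rotated honeycomb lattice*, J. Phys. A 47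
(2014) 075003, arXiv:1210.0274v3 — Theorem 1 (p. 2: `y_c = √((2+√2)/(1+√2−√(2+√2)))`), §3.1 and Proposition 7 (p. 11: `C_n^+(y)`,
`μ(y)`, `y_c`), §3.2 (Propositions 8–9, Corollary 10, p. 15), §4 (p. 16; Lemma 12 and Proposition 11 p. 17; proof of Proposition 11
with the last-contact cut, p. 18, Fig. 7); the DCS-frame twin is BBdGDCG14 / Glazman–Manolescu 2020 (tree files `HexSAWSurfaceYc*`).
READING AS PRINTED (a-idea-1 g18, lit-1 g12 07:34Z): (i) `hexRotSurfaceYc` is the RADIUS FORM `sup {y ≥ 0 : ∀ 0 < x < x_c, the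
box-truncated C⁺(x,y) is bounded}` = `sup {y ≥ 0 : limsup_n C_n^+(y)^{1/n} ≤ μ}` unconditionally; = Proposition 7's `y_c` granted the
HTW82 existence clause (neither used nor formalised); (ii) the walk model: vertex self-avoiding lists from `a⁺ = hvOrigin` in the
half-plane `{ξ ≤ 0}`, weight `x^{#vertices} y^{#vertices on ξ = 0}` — Beaton's `m` = the surface count, `n` = the vertex count up to
bounded factors (radii invariant); (iii) the strip side is K96.1's vocabulary verbatim (`HV.rotStripV`, `HV.rotGFy`, `HV.topContacts`,
`IsRotTopDart`), `rotStripGFxy … x_c y = HV.rotGFy …` by `rfl`.  LABEL (lit-1): CONSOLIDATION — Beaton's Theorem 1 by a route not printed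
in this frame (Corollary-10-free: no `y_T → y_c` limit, no HTW existence clause), explicit constants, kernel-checked.
DESIGN AND AUTHORSHIP.  Statements and proofs are a-idea-1 gen 18's HOME sketch `Sketch_G18_RotYcPrint.lean` ed.5 (sha16
490f2f22050d7d50, 2026-08-23) VERBATIM, moved to the tree namespace `…SAW.HV` by the filer lineage a-p6 (gen 8 cut); `TailCount` /
`tailCount_holds` are the tree's (`HexSAWSurfaceYcFaces.lean`, same text).
EDITION ed.2 (filer a-p6 gen 9, 2026-08-23): the two bookkeeping lemmas `sum_union_le_add` and `sum_biUnion_sawFin_le` of ed.1 were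
verbatim restatements of the landed DCS-frame twins `HV.YcCut.sum_union_le_add` / `HV.YcCut.sum_biUnion_sawFin_le`
(`HexSAWSurfaceYcCut.lean`); ed.2 imports that file and uses them BY NAME (copies deleted, two call sites re-pointed; every other
declaration byte-identical to the custodied ed.1 adcdbbbdb1e9f1c2).
THIS FILE: D1ʳ `RotHalfPlaneCut` / `rotHalfPlaneCut_holds` — a half-plane walk of the rotated box is cut at its LAST surface vertex (the
continuation's first step is the unique DOWN neighbour, tail factor `1 + xZ`; depth-0 heads are `[a⁺]`, `[a⁺, a⁻]` since the surface row
is a perfect matching of dimers) and the head at its LAST DEEPEST vertex into two reflected, normalised TOP walks of `D(D+1, W′)` — the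
printed rotated last-contact cut of Beaton §4, proof of Proposition 11 (arXiv v3 p. 18, Fig. 7), applied twice — whence
`C^+_{T,L}(x,y) ≤ (1 + xZ)(xy + x²y² + 2x⁻³ Σ_{H'=2}^{T+1} b(H')²)`.  The D1ʳ machinery (`rwt`, `lastSurf/hdR/tlR`, `lastDeep/pivotR/hOf/phR/RB1/RB3`,
`tWt`, and their lemmas) lives in the sub-namespace `…SAW.HV.RotYcCut`; the face is re-exported as `HV.rotHalfPlaneCut_holds`.
-/

noncomputable section

open Finset Filter Topology

namespace Literature.Probability.RandomPlanarGeometry.SAW.HV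

/-! ### The face D1ʳ -/

/-- **D1ʳ «ROT-HALF-PLANE-CUT» (OPEN → to be proved below).**  With `b(H')` bounding `B_{H',W'}(x; y)` for all widths, `c` bounding the
rooted SAW counts and `z ≥ Σ_{m<N} c_m x^m`: `C^+_{T,L}(x,y) ≤ (1 + x z)(x y + x² y² + 2 x⁻³ Σ_{H'=2}^{T+1} b(H')²)`.
Proof design: cut at the last surface visit (the continuation is the unique DOWN neighbour: tail factor `1 + xz`); a head of depth `0` is
`[a⁺]` or `[a⁺, a⁻]`; a head of depth `D ≥ 1` is cut at its last deepest vertex into two pieces, each mapped (reverse the first; point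
reflection `flip`, `ξ`-shift by `−(D+1)`, then a `ξ`-preserving normalisation taking the pivot to the down-neighbour `(−1,0,true)` of `a⁺`)
to the inner list of a TOP walk of `D(D+1, W')` with `a⁺` prepended; lengths add to `|h| + 3`, top contacts add to the surface count, and
the pair determines the head within its class `H' = D + 1`.
[cite: Beaton2014RotatedHoneycomb, §4, proof of Proposition 11 (arXiv v3 p. 18: "can be factored into two pieces by cutting it at the mid-edge immediately following its last surface contact", Fig. 7); Beaton2014RotatedHoneycomb, §3.1 (arXiv v3 p. 11) and §4 (p. 16); HammersleyWelsh1962; DuminilCopinSmirnov2012, §3 (bridge decomposition)] -/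
def RotHalfPlaneCut : Prop := ∀ (x y : ℝ), 0 < x → x ≤ 1 → 0 ≤ y → ∀ (b c : ℕ → ℝ) (z : ℝ),
  (∀ H' W' : ℕ, 1 ≤ H' → rotStripGFxy H' W' (IsRotTopDart H') x y ≤ b H') →
  (∀ (v : HV) (m : ℕ), (sawCount hvGraph v m : ℝ) ≤ c m) → (∀ N : ℕ, ∑ m ∈ range N, c m * x ^ m ≤ z) →
  ∀ T L : ℕ, rotHpGF T L x y ≤ (1 + x * z) * (x * y + x ^ 2 * y ^ 2 + 2 * x⁻¹ ^ 3 * ∑ H' ∈ Icc 2 (T + 1), b H' * b H')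

namespace RotYcCut

/-! ### D1ʳ, Step B: cut at the LAST visit to the surface row `ξ = 0`; the tail costs a factor `≤ 1 + xZ(x)` -/

section RCutB

variable {T L : ℕ} {l : List HV}

/-- Weight of a vertex list in the rotated half-plane sum: `x^{|l|} y^{#{v ∈ l : ξ v = 0}}`. [cite: Beaton2014RotatedHoneycomb, §3.1 (arXiv v3 p. 11: C⁺_n(y))] -/
def rwt (x y : ℝ) (l : List HV) : ℝ := x ^ l.length * y ^ surfCount l

/-- `rwt ≥ 0`. [cite: Beaton2014RotatedHoneycomb, §3.1 (C^+_n(y), arXiv v3 p. 11)] -/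
theorem rwt_nonneg {x y : ℝ} (hx : 0 ≤ x) (hy : 0 ≤ y) (l : List HV) : 0 ≤ rwt x y l :=
  mul_nonneg (pow_nonneg hx _) (pow_nonneg hy _)

/-- `C^+_{T,L}(x,y) = Σ rwt`. [cite: Beaton2014RotatedHoneycomb, §3.1 (C^+_n(y), arXiv v3 p. 11)] -/
theorem rotHpGF_eq_sum_rwt (T L : ℕ) (x y : ℝ) : rotHpGF T L x y = ∑ l ∈ rotHpLists T L, rwt x y l := rfl

/-- The index of the LAST visit to the surface row (last index of maximal `ξ`; tree `lastArgminBy`). [cite: DuminilCopinSmirnov2012, §3 ("choose the one visited last")] -/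
def lastSurf (l : List HV) : ℕ := lastArgminBy (fun v => -xi v) l

/-- The index of the LAST DEEPEST vertex (last index of minimal `ξ`). [cite: DuminilCopinSmirnov2012, §3] -/
def lastDeep (l : List HV) : ℕ := lastArgminBy xi l

/-- Specification of `lastSurf`. [cite: Beaton2014RotatedHoneycomb, §4, proof of Proposition 11 (arXiv v3 p. 18, Fig. 7: the last-contact cut)] -/
theorem lastSurf_spec (hl : l ≠ []) :
    ∃ hm : lastSurf l < l.length, (∀ (j : ℕ) (hj : j < l.length), xi l[j] ≤ xi l[lastSurf l]) ∧
      ∀ (j : ℕ) (hj : j < l.length), lastSurf l < j → xi l[j] < xi l[lastSurf l] := by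
  obtain ⟨hm, h1, h2⟩ := lastArgminBy_spec (fun v => -xi v) hl
  refine ⟨hm, fun j hj => ?_, fun j hj hlt => ?_⟩
  · have := h1 j hj
    rw [getD_eq_getElem' hm, getD_eq_getElem' hj] at this
    simpa [lastSurf] using this
  · have := h2 j hj hlt
    rw [getD_eq_getElem' hm, getD_eq_getElem' hj] at this
    simpa [lastSurf] using this

/-- Specification of `lastDeep`. [cite: Beaton2014RotatedHoneycomb, §4, proof of Proposition 11 (arXiv v3 p. 18, Fig. 7: the last-contact cut); DuminilCopinSmirnov2012, §3, proof of Theorem 1 (bridge decomposition at the last extremal vertex, arXiv PDF p. 8)] -/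
theorem lastDeep_spec (hl : l ≠ []) :
    ∃ hm : lastDeep l < l.length, (∀ (j : ℕ) (hj : j < l.length), xi l[lastDeep l] ≤ xi l[j]) ∧
      ∀ (j : ℕ) (hj : j < l.length), lastDeep l < j → xi l[lastDeep l] < xi l[j] := by
  obtain ⟨hm, h1, h2⟩ := lastArgminBy_spec xi hl
  refine ⟨hm, fun j hj => ?_, fun j hj hlt => ?_⟩
  · have := h1 j hj
    rw [getD_eq_getElem' hm, getD_eq_getElem' hj] at this
    exact this
  · have := h2 j hj hlt
    rw [getD_eq_getElem' hm, getD_eq_getElem' hj] at this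
    exact this

/-- Head piece: the list up to its LAST surface vertex. [cite: DuminilCopinSmirnov2012, §3; HammersleyWelsh1962] -/
def hdR (l : List HV) : List HV := l.take (lastSurf l + 1)

/-- Tail piece: after the last surface vertex. [cite: DuminilCopinSmirnov2012, §3; HammersleyWelsh1962] -/
def tlR (l : List HV) : List HV := l.drop (lastSurf l + 1)

/-- `l = hdR l ++ tlR l`. [cite: Beaton2014RotatedHoneycomb, §4, proof of Proposition 11 (arXiv v3 p. 18, Fig. 7: the last-contact cut)] -/
theorem hdR_append_tlR (l : List HV) : hdR l ++ tlR l = l := List.take_append_drop _ _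

/-- Unpacking `rotHpLists`. [cite: Beaton2014RotatedHoneycomb, §3.1 (C^+_n(y), arXiv v3 p. 11)] -/
theorem of_mem_rotHpLists (hl : l ∈ rotHpLists T L) :
    l ≠ [] ∧ l.IsChain hvGraph.Adj ∧ l.head? = some hvOrigin ∧ l.Nodup ∧ ∀ v ∈ l, v ∈ rotHpV T L := by
  obtain ⟨hc, hh, hnd, hV⟩ := mem_rotHpLists_iff.1 hl
  exact ⟨by rintro rfl; simp at hh, hc, hh, hnd, hV⟩

/-- On `rotHpLists` the last vertex of maximal `ξ` is on the surface row and everything after it is strictly below. [cite: DuminilCopinSmirnov2012, §3] -/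
theorem xi_lastSurf_eq_zero (hl : l ∈ rotHpLists T L) :
    ∃ hm : lastSurf l < l.length, xi l[lastSurf l] = 0 ∧ ∀ (j : ℕ) (hj : j < l.length), lastSurf l < j → xi l[j] < 0 := by
  obtain ⟨hne, hc, hh, hnd, hV⟩ := of_mem_rotHpLists hl
  obtain ⟨hm, hmax, hstrict⟩ := lastSurf_spec hne
  have h0 : l[0]'(List.length_pos_of_ne_nil hne) = hvOrigin := by
    rw [List.head?_eq_getElem?, List.getElem?_eq_getElem (List.length_pos_of_ne_nil hne)] at hh
    exact Option.some_inj.1 hh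
  have hle : xi l[lastSurf l] ≤ 0 := by have := (mem_rotHpV_iff.1 (hV _ (List.getElem_mem hm))).1; omega
  have hge := hmax 0 (List.length_pos_of_ne_nil hne)
  rw [h0, xi_hvOrigin] at hge
  have heq : xi l[lastSurf l] = 0 := le_antisymm hle hge
  exact ⟨hm, heq, fun j hj hlt => by have := hstrict j hj hlt; omega⟩

/-- Splitting a weight at a tail with no surface vertex. [cite: Beaton2014RotatedHoneycomb, §4, proof of Proposition 11 (arXiv v3 p. 18, Fig. 7: the last-contact cut)] -/
theorem rwt_append_of_filter_nil (x y : ℝ) {h t : List HV} (ht : t.filter (fun v => xi v = 0) = []) :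
    rwt x y (h ++ t) = rwt x y h * x ^ t.length := by
  rw [rwt, rwt, surfCount, surfCount, List.length_append, List.filter_append, ht, List.append_nil, pow_add]; ring

/-- The tail carries no surface weight. [cite: DuminilCopinSmirnov2012, §3, proof of Theorem 1 (bridge decomposition at the last extremal vertex, arXiv PDF p. 8); HammersleyWelsh1962] -/
theorem filter_tlR_eq_nil (hl : l ∈ rotHpLists T L) : (tlR l).filter (fun v => xi v = 0) = [] := by
  obtain ⟨hm, -, hneg⟩ := xi_lastSurf_eq_zero hl
  rw [List.filter_eq_nil_iff]
  intro v hv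
  rw [tlR, List.mem_iff_getElem] at hv
  obtain ⟨i, hi, rfl⟩ := hv
  rw [List.length_drop] at hi
  rw [List.getElem_drop]
  have := hneg (lastSurf l + 1 + i) (by omega) (by omega)
  simp only [decide_eq_true_eq]; omega

/-- `rwt(l) = rwt(hdR l) · x^{|tlR l|}`. [cite: DuminilCopinSmirnov2012, §3, proof of Theorem 1 (bridge decomposition at the last extremal vertex, arXiv PDF p. 8); HammersleyWelsh1962] -/
theorem rwt_eq_hdR_tlR (hl : l ∈ rotHpLists T L) (x y : ℝ) : rwt x y l = rwt x y (hdR l) * x ^ (tlR l).length := by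
  conv_lhs => rw [← hdR_append_tlR l]
  exact rwt_append_of_filter_nil x y (filter_tlR_eq_nil hl)

/-- The head piece ends at the last surface vertex. [cite: Beaton2014RotatedHoneycomb, §4, proof of Proposition 11 (arXiv v3 p. 18, Fig. 7: the last-contact cut)] -/
theorem hdR_getLast? (hl : l ∈ rotHpLists T L) : ∃ hm : lastSurf l < l.length, (hdR l).getLast? = some l[lastSurf l] := by
  obtain ⟨hm, -, -⟩ := xi_lastSurf_eq_zero hl
  refine ⟨hm, ?_⟩
  rw [hdR, List.getLast?_eq_getElem?, List.length_take, Nat.min_eq_left (by omega), Nat.add_sub_cancel,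
    List.getElem?_take_of_lt (by omega), List.getElem?_eq_getElem hm]

/-- **A nonempty tail starts at the `ξ`-DOWN neighbour of the last surface vertex** (the lateral neighbour would be a later surface visit,
the up neighbour is outside the half-plane) and is a self-avoiding list of fewer than `|box|` vertices. [cite: Beaton2014RotatedHoneycomb, §3.1 (arXiv v3 p. 11: walks "begin on the mid-edge of a horizontal edge lying along the surface")] -/
theorem tlR_mem_biUnion (hl : l ∈ rotHpLists T L) {w : HV} (hw : (hdR l).getLast? = some w) (ht : tlR l ≠ []) :
    tlR l ∈ (range (rotHpV T L).card).biUnion fun n => sawFin (xiDown w) n := by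
  obtain ⟨hne, hc, hh, hnd, hV⟩ := of_mem_rotHpLists hl
  obtain ⟨hm, h0, hneg⟩ := xi_lastSurf_eq_zero hl
  obtain ⟨hm', e⟩ := hdR_getLast? hl
  rw [e, Option.some_inj] at hw
  have hlt : lastSurf l + 1 < l.length := by
    by_contra hge; apply ht; rw [tlR, List.drop_eq_nil_iff]; omega
  have hadj : hvGraph.Adj l[lastSurf l] l[lastSurf l + 1] := hc.getElem _ hlt
  have hx1 := hneg (lastSurf l + 1) hlt (by omega)
  have hdn : l[lastSurf l + 1] = xiDown w := by
    rw [← hw]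
    refine (eq_xiDown_or_xiSide_of_adj hadj).1 ?_
    rcases xi_adj hadj with h' | h' | h' <;> omega
  rw [mem_biUnion]
  refine ⟨(tlR l).length - 1, ?_, ?_⟩
  · rw [mem_range]
    have hlen : l.length ≤ (rotHpV T L).card := by
      rw [← List.toFinset_card_of_nodup hnd]; exact card_le_card fun v hv => hV v (List.mem_toFinset.1 hv)
    rw [tlR, List.length_drop]; omega
  · rw [mem_sawFin_iff, mem_sawLists_iff]
    refine ⟨hc.drop _, ?_, ?_, hnd.sublist (List.drop_sublist _ _)⟩
    · rw [tlR, List.head?_drop, List.getElem?_eq_getElem hlt, hdn]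
    · have : 0 < (tlR l).length := List.length_pos_of_ne_nil ht
      omega

/-- **The tails over a fixed head weigh at most `1 + xz`**: the empty tail, or a self-avoiding list from THE down neighbour of the
last surface vertex. [cite: DuminilCopinSmirnov2012, §1; HammersleyWelsh1962] -/
theorem sum_fiber_tails_le {x : ℝ} (hx : 0 ≤ x) (c : ℕ → ℝ) (z : ℝ)
    (hc : ∀ (v : HV) (m : ℕ), (sawCount hvGraph v m : ℝ) ≤ c m) (hz : ∀ N : ℕ, ∑ m ∈ range N, c m * x ^ m ≤ z)
    {l₀ : List HV} (hl₀ : l₀ ∈ rotHpLists T L) :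
    ∑ l ∈ (rotHpLists T L).filter (fun l => hdR l = hdR l₀), x ^ (tlR l).length ≤ 1 + x * z := by
  classical
  obtain ⟨hm₀, hw₀⟩ := hdR_getLast? hl₀
  set w := l₀[lastSurf l₀]
  set N := (rotHpV T L).card
  set B : Finset (List HV) := (range N).biUnion fun n => sawFin (xiDown w) n with hB
  set Tt : Finset (List HV) := {[]} ∪ B with hTt
  have hmaps : ∀ l ∈ (rotHpLists T L).filter (fun l => hdR l = hdR l₀), tlR l ∈ Tt := by
    intro l hl
    obtain ⟨hlS, hEq⟩ := mem_filter.1 hl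
    rw [hTt, mem_union, mem_singleton]
    by_cases ht : tlR l = []
    · exact Or.inl ht
    · exact Or.inr (tlR_mem_biUnion hlS (by rw [hEq]; exact hw₀) ht)
  have hinj : Set.InjOn tlR ((rotHpLists T L).filter (fun l => hdR l = hdR l₀) : Finset (List HV)) := by
    intro l hl l' hl' h
    rw [Finset.mem_coe, mem_filter] at hl hl'
    rw [← hdR_append_tlR l, ← hdR_append_tlR l', hl.2, hl'.2, h]
  have hnn : ∀ t : List HV, 0 ≤ x ^ t.length := fun t => pow_nonneg hx _
  calc ∑ l ∈ (rotHpLists T L).filter (fun l => hdR l = hdR l₀), x ^ (tlR l).length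
      ≤ ∑ t ∈ Tt, x ^ t.length := sum_le_sum_of_injOn_of_nonneg tlR hinj hmaps (fun t => x ^ t.length) fun t _ => hnn t
    _ ≤ ∑ t ∈ ({[]} : Finset (List HV)), x ^ t.length + ∑ t ∈ B, x ^ t.length := YcCut.sum_union_le_add fun t _ => hnn t
    _ ≤ 1 + x * z := by
        rw [sum_singleton, List.length_nil, pow_zero]
        have h1 := YcCut.sum_biUnion_sawFin_le hx c z hc hz (xiDown w) N
        linarith

/-- **Step B**: `Σ_{l ∈ rotHpLists} rwt(l) ≤ (1 + xz) · Σ_{h ∈ heads} rwt(h)`. [cite: DuminilCopinSmirnov2012, §3; HammersleyWelsh1962] -/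
theorem sum_rotHpLists_le_heads {x y : ℝ} (hx : 0 ≤ x) (hy : 0 ≤ y) (c : ℕ → ℝ) (z : ℝ)
    (hc : ∀ (v : HV) (m : ℕ), (sawCount hvGraph v m : ℝ) ≤ c m) (hz : ∀ N : ℕ, ∑ m ∈ range N, c m * x ^ m ≤ z) :
    ∑ l ∈ rotHpLists T L, rwt x y l ≤ (1 + x * z) * ∑ h ∈ (rotHpLists T L).image hdR, rwt x y h := by
  classical
  rw [← sum_fiberwise_of_maps_to (g := hdR) (fun l hl => mem_image_of_mem hdR hl), mul_sum]
  refine sum_le_sum fun h hh => ?_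
  obtain ⟨l₀, hl₀, rfl⟩ := mem_image.1 hh
  calc ∑ l ∈ (rotHpLists T L).filter (fun l => hdR l = hdR l₀), rwt x y l
      = ∑ l ∈ (rotHpLists T L).filter (fun l => hdR l = hdR l₀), rwt x y (hdR l₀) * x ^ (tlR l).length :=
        sum_congr rfl fun l hl => by obtain ⟨hlS, hEq⟩ := mem_filter.1 hl; rw [rwt_eq_hdR_tlR hlS, hEq]
    _ = rwt x y (hdR l₀) * ∑ l ∈ (rotHpLists T L).filter (fun l => hdR l = hdR l₀), x ^ (tlR l).length := by rw [mul_sum]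
    _ ≤ rwt x y (hdR l₀) * (1 + x * z) := mul_le_mul_of_nonneg_left (sum_fiber_tails_le hx c z hc hz hl₀) (rwt_nonneg hx hy _)
    _ = (1 + x * z) * rwt x y (hdR l₀) := mul_comm _ _

end RCutB

/-! ### D1ʳ, Step C: a head of depth `D ≥ 1` is cut at its LAST DEEPEST vertex into two top lists of `D(D+1, W')` -/

section RCutC

variable {T L : ℕ} {h : List HV}

/-- The heads: nonempty self-avoiding lists from `a⁺` in the box ENDING ON THE SURFACE ROW. [cite: DuminilCopinSmirnov2012, §3, proof of Theorem 1 (bridge decomposition at the last extremal vertex, arXiv PDF p. 8); HammersleyWelsh1962] -/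
theorem of_mem_headsR (hh : h ∈ (rotHpLists T L).image hdR) :
    h.IsChain hvGraph.Adj ∧ h.head? = some hvOrigin ∧ h.Nodup ∧ (∀ v ∈ h, v ∈ rotHpV T L) ∧
      ∃ hne : h ≠ [], xi (h.getLast hne) = 0 := by
  obtain ⟨l, hl, rfl⟩ := mem_image.1 hh
  obtain ⟨hne, hc, hh0, hnd, hV⟩ := of_mem_rotHpLists hl
  obtain ⟨hm, h0, -⟩ := xi_lastSurf_eq_zero hl
  have hne' : hdR l ≠ [] := by rw [hdR]; simp [hne]
  refine ⟨hc.take _, by rw [hdR, List.head?_take]; simpa using hh0, hnd.sublist (List.take_sublist _ _),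
    fun v hv => hV v (List.mem_of_mem_take hv), hne', ?_⟩
  obtain ⟨hm', e⟩ := hdR_getLast? hl
  rw [List.getLast?_eq_some_getLast hne', Option.some_inj] at e
  rw [e, h0]

/-- The pivot: the LAST DEEPEST vertex. [cite: DuminilCopinSmirnov2012, §3 ("choose the one visited last")] -/
def pivR (h : List HV) : HV := h.getD (lastDeep h) hvOrigin

/-- The depth `D = −ξ(pivot)`. [cite: Beaton2014RotatedHoneycomb, §2.2 (height of D_{T,L})] -/
def dOf (h : List HV) : ℕ := (-xi (pivR h)).toNat

/-- The strip height `H' = D + 1` of the two pieces. [cite: Beaton2014RotatedHoneycomb, §2.2] -/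
def hOf (h : List HV) : ℕ := dOf h + 1

/-- The width `W'` of the target strip. [folklore] -/
def wOf (T L : ℕ) : ℕ := 4 * T + 4 * L + 12

/-- The class `(H', type of the pivot)` of a head. [folklore] -/
def clsR (h : List HV) : ℕ × Bool := (hOf h, (pivR h).2.2)

/-- **The normalised reflection for the pieces** `P_{H,c,a}`: `reflX ∘ σ_{H,a}` if the pivot type `c` is `true`, `σ_{H,a-1}` if `false` — chosen so
that a vertex `w` of type `c`, abscissa `a` and `ξ w = 1 − H` goes to the down-neighbour `xiDown a⁺ = (−1, 0, true)` of `a⁺`.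
[cite: Beaton2014RotatedHoneycomb, §2.2 (reflection symmetry of D_{T,L}); §3.2 (arXiv v3 p. 15: "by the symmetry of bridges")] -/
def pmap (H : ℕ) (c : Bool) (a : ℤ) : hvGraph ≃g hvGraph := cond c (rsigR H a) (rsig H (a - 1))

/-- `pmap H true a = rsigR H a`. [cite: Beaton2014RotatedHoneycomb, §3.2 ("By the symmetry of bridges", arXiv v3 p. 15); Beaton2014RotatedHoneycomb, §4, proof of Proposition 11 (arXiv v3 p. 18, Fig. 7: the last-contact cut)] -/
@[simp] theorem pmap_true (H : ℕ) (a : ℤ) : pmap H true a = rsigR H a := rfl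
/-- `pmap H false a = rsig H (a − 1)`. [cite: Beaton2014RotatedHoneycomb, §3.2 ("By the symmetry of bridges", arXiv v3 p. 15); Beaton2014RotatedHoneycomb, §4, proof of Proposition 11 (arXiv v3 p. 18, Fig. 7: the last-contact cut)] -/
@[simp] theorem pmap_false (H : ℕ) (a : ℤ) : pmap H false a = rsig H (a - 1) := rfl

/-- Heights under the piece map: `ξ ↦ −H − ξ`. [cite: Beaton2014RotatedHoneycomb, §3.2 ("By the symmetry of bridges", arXiv v3 p. 15); Beaton2014RotatedHoneycomb, §4, proof of Proposition 11 (arXiv v3 p. 18, Fig. 7: the last-contact cut)] -/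
theorem xi_pmap (H : ℕ) (c : Bool) (a : ℤ) (v : HV) : xi (pmap H c a v) = -(H : ℤ) - xi v := by
  cases c
  · rw [pmap_false, xi_rsig]
  · rw [pmap_true, xi_rsigR]

/-- `P` sends its reference vertex to `xiDown a⁺`. [cite: Beaton2014RotatedHoneycomb, §3.2 ("By the symmetry of bridges", arXiv v3 p. 15)] -/
theorem pmap_self (H : ℕ) {w : HV} (hw : xi w = 1 - (H : ℤ)) : pmap H w.2.2 w.1 w = xiDown hvOrigin := by
  obtain ⟨p, q, c⟩ := w
  cases c
  · simp only [pmap_false, rsig_apply, hvOrigin, xiDown, xi, bit_false, Bool.not_false, Bool.false_eq_true, ↓reduceIte] at hw ⊢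
    refine Prod.ext ?_ (Prod.ext ?_ rfl) <;> dsimp only <;> omega
  · simp only [pmap_true, rsigR_apply', rsig_apply, reflX_apply, hvOrigin, xiDown, xi, bit_false, bit_true, Bool.not_true,
      Bool.not_false, Bool.false_eq_true, ↓reduceIte] at hw ⊢
    refine Prod.ext ?_ (Prod.ext ?_ rfl) <;> dsimp only <;> omega

/-- The parameters `(c, a)` are read off the image of `a⁺`. [cite: Beaton2014RotatedHoneycomb, §3.2 ("By the symmetry of bridges", arXiv v3 p. 15)] -/
theorem pmap_hvOrigin_inj (H : ℕ) {c₁ c₂ : Bool} {a₁ a₂ : ℤ} (h : pmap H c₁ a₁ hvOrigin = pmap H c₂ a₂ hvOrigin) :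
    c₁ = c₂ ∧ a₁ = a₂ := by
  cases c₁ <;> cases c₂ <;>
    simp only [pmap_false, pmap_true, rsigR_apply', rsig_apply, reflX_apply, hvOrigin, Prod.mk.injEq, bit_true,
      Bool.not_false, Bool.not_true] at h <;>
    first | exact ⟨rfl, by omega⟩ | (exfalso; simp at h)

/-- The map used on both pieces of a head. [cite: Beaton2014RotatedHoneycomb, §3.2 (arXiv v3 p. 15: "by the symmetry of bridges")] -/
def phR (h : List HV) : hvGraph ≃g hvGraph := pmap (hOf h) (pivR h).2.2 (pivR h).1

/-- **First piece** `RB₁(h)`: `a⁺ ::` the initial segment `a⁺ … pivot`, reversed and reflected (pivot ↦ `xiDown a⁺`, surface ↦ top row).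
[cite: DuminilCopinSmirnov2012, §3 (bridge decomposition); Beaton2014RotatedHoneycomb, §3.2] -/
def RB1 (h : List HV) : List HV := hvOrigin :: ((h.take (lastDeep h + 1)).reverse).map (phR h)

/-- **Second piece** `RB₃(h)`: `a⁺ ::` the final segment `pivot … last surface vertex`, reflected. [cite: DuminilCopinSmirnov2012, §3; Beaton2014RotatedHoneycomb, §3.2] -/
def RB3 (h : List HV) : List HV := hvOrigin :: (h.drop (lastDeep h)).map (phR h)

/-- Pivot facts: index, box membership, minimality, strictness after the pivot, `D = −ξ(pivot) ≤ T`. [cite: DuminilCopinSmirnov2012, §3] -/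
theorem pivR_facts (hh : h ∈ (rotHpLists T L).image hdR) :
    ∃ hq : lastDeep h < h.length, pivR h = h[lastDeep h] ∧ pivR h ∈ rotHpV T L ∧
      (∀ (j : ℕ) (hj : j < h.length), xi (pivR h) ≤ xi h[j]) ∧
      (∀ (j : ℕ) (hj : j < h.length), lastDeep h < j → xi (pivR h) < xi h[j]) ∧
      ((dOf h : ℕ) : ℤ) = -xi (pivR h) ∧ dOf h ≤ T := by
  obtain ⟨hc, hh0, hnd, hV, hne, -⟩ := of_mem_headsR hh
  obtain ⟨hq, hmin, hstrict⟩ := lastDeep_spec hne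
  have hpiv : pivR h = h[lastDeep h] := getD_eq_getElem' hq
  have hmem : pivR h ∈ rotHpV T L := by rw [hpiv]; exact hV _ (List.getElem_mem _)
  have hbox := mem_rotHpV_iff.1 hmem
  have hD : ((dOf h : ℕ) : ℤ) = -xi (pivR h) := by rw [dOf, Int.toNat_of_nonneg hbox.1]
  refine ⟨hq, hpiv, hmem, fun j hj => hpiv ▸ hmin j hj, fun j hj hlt => hpiv ▸ hstrict j hj hlt, hD, ?_⟩
  have := hbox.2.1; omega

/-- `H'` as an integer: `H' = 1 − ξ(pivot)`. [cite: Beaton2014RotatedHoneycomb, §4, proof of Proposition 11 (arXiv v3 p. 18, Fig. 7: the last-contact cut)] -/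
theorem hOf_cast (hh : h ∈ (rotHpLists T L).image hdR) : ((hOf h : ℕ) : ℤ) = 1 - xi (pivR h) := by
  obtain ⟨-, -, -, -, -, hD, -⟩ := pivR_facts hh
  rw [hOf]; push_cast; omega

/-- `ξ` under the piece map. [cite: Beaton2014RotatedHoneycomb, §3.2 ("By the symmetry of bridges", arXiv v3 p. 15); Beaton2014RotatedHoneycomb, §4, proof of Proposition 11 (arXiv v3 p. 18, Fig. 7: the last-contact cut)] -/
theorem xi_phR (hh : h ∈ (rotHpLists T L).image hdR) (v : HV) : xi (phR h v) = xi (pivR h) - 1 - xi v := by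
  rw [phR, xi_pmap, hOf_cast hh]; ring

/-- The piece map sends the pivot to `xiDown a⁺`. [cite: Beaton2014RotatedHoneycomb, §4, proof of Proposition 11 (arXiv v3 p. 18, Fig. 7: the last-contact cut)] -/
theorem phR_pivR (hh : h ∈ (rotHpLists T L).image hdR) : phR h (pivR h) = xiDown hvOrigin :=
  pmap_self _ (by rw [hOf_cast hh]; ring)

/-- `r(a⁺) = a⁻`. [cite: Beaton2014RotatedHoneycomb, §2.2 (the rotated domains D_{T,L} and their reflection symmetry)] -/
theorem xiSide_hvOrigin : xiSide hvOrigin = wOut := by simp [xiSide, hvOrigin, wOut]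

/-- `r(a⁻) = a⁺`. [cite: Beaton2014RotatedHoneycomb, §2.2 (the rotated domains D_{T,L} and their reflection symmetry)] -/
theorem xiSide_wOut : xiSide wOut = hvOrigin := by simp [xiSide, hvOrigin, wOut]

/-- **Heads of depth `0` are `[a⁺]` or `[a⁺, a⁻]`** (the surface row is a set of dimers). [cite: Beaton2014RotatedHoneycomb, §3.1 (arXiv v3 p. 11)] -/
theorem eq_of_dOf_eq_zero (hh : h ∈ (rotHpLists T L).image hdR) (h0 : dOf h = 0) : h = [hvOrigin] ∨ h = [hvOrigin, wOut] := by
  obtain ⟨hc, hh0, hnd, hV, hne, -⟩ := of_mem_headsR hh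
  obtain ⟨hq, hpiv, hmem, hmin, -, hD, -⟩ := pivR_facts hh
  have hall : ∀ (j : ℕ) (hj : j < h.length), xi h[j] = 0 := by
    intro j hj
    have h1 := hmin j hj
    have h2 := (mem_rotHpV_iff.1 (hV _ (List.getElem_mem hj))).1
    rw [h0] at hD; push_cast at hD; omega
  obtain ⟨v, rest, rfl⟩ := List.exists_cons_of_ne_nil hne
  simp only [List.head?_cons, Option.some.injEq] at hh0
  subst hh0
  rcases rest with _ | ⟨w, rest'⟩
  · exact Or.inl rfl
  have hc' := List.isChain_cons_cons.1 hc
  have hw0 : xi w = 0 := by have := hall 1 (by simp); simpa using this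
  have hw : w = wOut := by
    rw [← xiSide_hvOrigin]; exact (eq_xiDown_or_xiSide_of_adj hc'.1).2 (by rw [xi_hvOrigin, hw0])
  subst hw
  rcases rest' with _ | ⟨u, rest''⟩
  · exact Or.inr rfl
  exfalso
  have hadj' : hvGraph.Adj wOut u := (List.isChain_cons_cons.1 hc'.2).1
  have hu0 : xi u = 0 := by have := hall 2 (by simp); simpa using this
  have hu : u = hvOrigin := by
    rw [← xiSide_wOut]; exact (eq_xiDown_or_xiSide_of_adj hadj').2 (by rw [xi_wOut, hu0])
  subst hu
  simp at hnd

/-- `1 ≤ H'`. [cite: Beaton2014RotatedHoneycomb, §4, proof of Proposition 11 (arXiv v3 p. 18, Fig. 7: the last-contact cut)] -/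
theorem one_le_hOf (h : List HV) : 1 ≤ hOf h := by rw [hOf]; omega

/-- `a⁺ ≠ a⁻`. [cite: DuminilCopinSmirnov2012, §1 (mid-edge self-avoiding walks)] -/
theorem hvOrigin_ne_wOut : hvOrigin ≠ wOut := by simp [hvOrigin, wOut]

/-- **The piece map sends box vertices no higher than … (all of them: `ξ ≥ ξ(pivot)`) into `D(H', W') ∖ {a⁻}`, strictly below the surface.**
[cite: Beaton2014RotatedHoneycomb, §2.2] -/
theorem phR_mem (hh : h ∈ (rotHpLists T L).image hdR) (h1 : 1 ≤ dOf h) {v : HV} (hv : v ∈ rotHpV T L)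
    (hge : xi (pivR h) ≤ xi v) : phR h v ∈ (rotStripV (hOf h) (wOf T L)).erase wOut ∧ xi (phR h v) ≤ -1 := by
  obtain ⟨hq, hpiv, hmem, -, -, hD, hDT⟩ := pivR_facts hh
  have hξ := xi_phR hh v
  have hH := hOf_cast hh
  have hbv := mem_rotHpV_iff.1 hv
  have hbp := mem_rotHpV_iff.1 hmem
  have hξ1 : xi (phR h v) ≤ -1 := by omega
  refine ⟨mem_erase.2 ⟨fun e => by rw [e, xi_wOut] at hξ1; omega, ?_⟩, hξ1⟩
  rw [mem_rotStripV_iff]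
  refine Or.inr (Or.inr ⟨by omega, by omega, ?_⟩)
  -- lateral extent
  have hX : xX (phR h v) = 3 * (hOf h : ℤ) + 6 * (pivR h).1 + xX v ∨ xX (phR h v) = 6 - 3 * (hOf h : ℤ) - 6 * ((pivR h).1 - 1) - xX v := by
    rw [phR]; cases (pivR h).2.2
    · exact Or.inr (by rw [pmap_false, xX_rsig])
    · exact Or.inl (by rw [pmap_true, xX_rsigR])
  have hp : |(pivR h).1| ≤ T + L + 2 := by
    revert hbp
    generalize pivR h = w
    intro hbp
    obtain ⟨p, q, c⟩ := w
    cases c <;> simp only [xi, xX, bit_true, bit_false, abs_lt, abs_le] at hbp ⊢ <;> omega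
  rw [abs_le] at hp
  rw [abs_lt] at hbv ⊢
  rw [wOf]; push_cast
  rcases hX with hX | hX <;> rw [hX] <;> constructor <;> omega

/-- A generic closing step: `a⁺ :: M` is a top list of `D(H', W')` when `M` is a reflected piece starting at `xiDown a⁺`.
[cite: Beaton2014RotatedHoneycomb, §2.2] -/
theorem cons_mem_rotTopLists {H' W' : ℕ} (hH' : 1 ≤ H') {M : List HV} (hM : M ≠ []) (hc : M.IsChain hvGraph.Adj) (hnd : M.Nodup)
    (hhd : M.head? = some (xiDown hvOrigin)) (hV : ∀ v ∈ M, v ∈ (rotStripV H' W').erase wOut ∧ xi v ≤ -1)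
    (hlast : xi (M.getLast hM) = -(H' : ℤ)) : hvOrigin :: M ∈ rotTopLists H' W' := by
  rw [mem_rotTopLists_iff hH']
  obtain ⟨m, M', rfl⟩ := List.exists_cons_of_ne_nil hM
  simp only [List.head?_cons, Option.some.injEq] at hhd
  subst hhd
  refine ⟨List.isChain_cons_cons.2 ⟨adj_xiDown _, hc⟩, rfl, List.nodup_cons.2 ⟨fun hO => ?_, hnd⟩, ?_, List.cons_ne_nil _ _, ?_⟩
  · have := (hV _ hO).2; rw [xi_hvOrigin] at this; omega
  · intro v hv
    rcases List.mem_cons.1 hv with rfl | hv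
    · exact mem_erase.2 ⟨hvOrigin_ne_wOut, hvOrigin_mem_rotStripV _ _⟩
    · exact (hV v hv).1
  · rw [List.getLast_cons hM]; exact hlast

/-- **`RB₃(h)` is a top list of `D(H', W')`** (stated with opaque `H' = hOf h`, `W' = wOf T L`: keeps the strip finset out of `whnf`'s reach).
[cite: DuminilCopinSmirnov2012, §3; Beaton2014RotatedHoneycomb, §3.2] -/
theorem RB3_mem (hh : h ∈ (rotHpLists T L).image hdR) (h1 : 1 ≤ dOf h) {H' W' : ℕ} (hH : hOf h = H') (hW : wOf T L = W') :
    RB3 h ∈ rotTopLists H' W' := by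
  have Hh := of_mem_headsR hh
  have Hp := pivR_facts hh
  have hc := Hh.1
  have hnd := Hh.2.2.1
  have hV := Hh.2.2.2.1
  have hne : h ≠ [] := Hh.2.2.2.2.fst
  have hlast : xi (h.getLast hne) = 0 := Hh.2.2.2.2.snd
  have hq : lastDeep h < h.length := Hp.fst
  have hpiv : pivR h = h[lastDeep h] := Hp.snd.1
  have hmin : ∀ j (hj : j < h.length), xi (pivR h) ≤ xi h[j] := Hp.snd.2.2.1
  have hMne : (h.drop (lastDeep h)).map (phR h) ≠ [] := by
    intro e
    rw [List.map_eq_nil_iff, List.drop_eq_nil_iff] at e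
    omega
  rw [show RB3 h = hvOrigin :: (h.drop (lastDeep h)).map (phR h) from rfl]
  refine cons_mem_rotTopLists (hH ▸ one_le_hOf h) hMne ?_ ?_ ?_ ?_ ?_
  · rw [List.isChain_map]
    exact (hc.drop _).imp fun u v (huv : hvGraph.Adj u v) => (phR h).map_rel_iff.2 huv
  · exact (hnd.sublist (List.drop_sublist _ _)).map (phR h).injective
  · rw [List.head?_map, List.head?_drop, List.getElem?_eq_getElem hq, Option.map_some, ← hpiv, phR_pivR hh]
  · intro v hv
    rw [List.mem_map] at hv
    obtain ⟨u, hu, rfl⟩ := hv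
    obtain ⟨j, hj, rfl⟩ := List.getElem_of_mem (List.mem_of_mem_drop hu)
    rw [← hH, ← hW]
    exact phR_mem hh h1 (hV _ (List.getElem_mem hj)) (hmin j hj)
  · have e : ((h.drop (lastDeep h)).map (phR h)).getLast? = some (phR h (h.getLast hne)) := by
      rw [List.getLast?_map, List.getLast?_drop, if_neg (by omega), List.getLast?_eq_some_getLast hne, Option.map_some]
    rw [List.getLast?_eq_some_getLast hMne, Option.some_inj] at e
    rw [e, xi_phR hh, hlast, ← hH, hOf_cast hh]; ring

/-- **`RB₁(h)` is a top list of `D(H', W')`** (same opaque-parameter form). [cite: DuminilCopinSmirnov2012, §3; Beaton2014RotatedHoneycomb, §3.2] -/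
theorem RB1_mem (hh : h ∈ (rotHpLists T L).image hdR) (h1 : 1 ≤ dOf h) {H' W' : ℕ} (hH : hOf h = H') (hW : wOf T L = W') :
    RB1 h ∈ rotTopLists H' W' := by
  have Hh := of_mem_headsR hh
  have Hp := pivR_facts hh
  have hc := Hh.1
  have hh0 := Hh.2.1
  have hnd := Hh.2.2.1
  have hV := Hh.2.2.2.1
  have hne : h ≠ [] := Hh.2.2.2.2.fst
  have hq : lastDeep h < h.length := Hp.fst
  have hpiv : pivR h = h[lastDeep h] := Hp.snd.1
  have hmin : ∀ j (hj : j < h.length), xi (pivR h) ≤ xi h[j] := Hp.snd.2.2.1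
  have htk : h.take (lastDeep h + 1) ≠ [] := by simp [hne]
  have hMne : ((h.take (lastDeep h + 1)).reverse).map (phR h) ≠ [] := by simpa using htk
  have etk : (h.take (lastDeep h + 1)).getLast? = some h[lastDeep h] := by
    rw [List.getLast?_eq_getElem?, List.length_take, Nat.min_eq_left (by omega), Nat.add_sub_cancel,
      List.getElem?_take_of_lt (by omega), List.getElem?_eq_getElem hq]
  rw [show RB1 h = hvOrigin :: ((h.take (lastDeep h + 1)).reverse).map (phR h) from rfl]
  refine cons_mem_rotTopLists (hH ▸ one_le_hOf h) hMne ?_ ?_ ?_ ?_ ?_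
  · rw [List.isChain_map, List.isChain_reverse]
    exact (hc.take _).imp fun u v (huv : hvGraph.Adj u v) => ((phR h).map_rel_iff.2 huv).symm
  · exact (List.nodup_reverse.2 (hnd.sublist (List.take_sublist _ _))).map (phR h).injective
  · rw [List.head?_map, List.head?_reverse, etk, Option.map_some, ← hpiv, phR_pivR hh]
  · intro v hv
    rw [List.mem_map] at hv
    obtain ⟨u, hu, rfl⟩ := hv
    rw [List.mem_reverse] at hu
    obtain ⟨j, hj, rfl⟩ := List.getElem_of_mem (List.mem_of_mem_take hu)
    rw [← hH, ← hW]
    exact phR_mem hh h1 (hV _ (List.getElem_mem hj)) (hmin j hj)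
  · have e : (((h.take (lastDeep h + 1)).reverse).map (phR h)).getLast? = some (phR h hvOrigin) := by
      rw [List.getLast?_map, List.getLast?_reverse, List.head?_take, if_neg (by omega), hh0, Option.map_some]
    rw [List.getLast?_eq_some_getLast hMne, Option.some_inj] at e
    rw [e, xi_phR hh, xi_hvOrigin, ← hH, hOf_cast hh]; ring

end RCutC

/-! ### D1ʳ, Step C (continued): weights, injectivity per class, the class sums, and `RotHalfPlaneCut` -/

section RCutD

variable {T L : ℕ} {h : List HV}

/-- Top-list weight in `D(H')`: `x^{|B|} y^{#top-row vertices}` (the summand of `rotStripGFxy_top_eq`). [cite: Beaton2014RotatedHoneycomb, §2.4 (B_{T,L}(x, y))] -/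
def tWt (H' : ℕ) (x y : ℝ) (B : List HV) : ℝ := x ^ B.length * y ^ (B.filter fun v => xi v = -(H' : ℤ)).length

/-- `tWt ≥ 0`. [cite: Beaton2014RotatedHoneycomb, §2.4 ("Including surface interactions: general y": the strip series with nonnegative coefficients)] -/
theorem tWt_nonneg (H' : ℕ) {x y : ℝ} (hx : 0 ≤ x) (hy : 0 ≤ y) (B : List HV) : 0 ≤ tWt H' x y B :=
  mul_nonneg (pow_nonneg hx _) (pow_nonneg hy _)

/-- `|RB₁| + |RB₃| = |h| + 3` (the pivot is shared; each piece carries the prepended `a⁺`). [cite: DuminilCopinSmirnov2012, §3] -/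
theorem length_RB1_add_RB3 (hh : h ∈ (rotHpLists T L).image hdR) : (RB1 h).length + (RB3 h).length = h.length + 3 := by
  obtain ⟨hq, -⟩ := pivR_facts hh
  simp only [RB1, RB3, List.length_cons, List.length_map, List.length_reverse, List.length_take, List.length_drop,
    Nat.min_eq_left (Nat.succ_le_of_lt hq)]
  omega

/-- The piece map turns surface vertices into top-row vertices, count for count. [cite: Beaton2014RotatedHoneycomb, §3.2] -/
theorem topCount_map_phR (hh : h ∈ (rotHpLists T L).image hdR) (M : List HV) :
    ((M.map (phR h)).filter fun v => xi v = -(hOf h : ℤ)).length = (M.filter fun v => xi v = 0).length := by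
  rw [List.filter_map, List.length_map]
  congr 1
  refine List.filter_congr fun v _ => ?_
  simp only [Function.comp_apply, xi_phR hh, decide_eq_decide, hOf_cast hh]
  omega

/-- **Surface counts add**: `#top(RB₁) + #top(RB₃) = #₀(h)` for a head of depth `≥ 1` (the shared pivot is below the surface, the prepended
`a⁺` is not on the top row). [cite: DuminilCopinSmirnov2012, §3] -/
theorem topCount_RB1_add_RB3 (hh : h ∈ (rotHpLists T L).image hdR) (h1 : 1 ≤ dOf h) :
    ((RB1 h).filter fun v => xi v = -(hOf h : ℤ)).length + ((RB3 h).filter fun v => xi v = -(hOf h : ℤ)).length = surfCount h := by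
  obtain ⟨hq, hpiv, -, -, -, hD, -⟩ := pivR_facts hh
  have hO : ¬ (xi hvOrigin = -(hOf h : ℤ)) := by rw [xi_hvOrigin, hOf]; push_cast; omega
  rw [RB1, RB3, List.filter_cons_of_neg (by simpa using hO), List.filter_cons_of_neg (by simpa using hO), topCount_map_phR hh,
    topCount_map_phR hh, List.filter_reverse, List.length_reverse, surfCount]
  have hdrop : h.drop (lastDeep h) = h[lastDeep h] :: h.drop (lastDeep h + 1) := List.drop_eq_getElem_cons hq
  have hnot : ¬ (xi h[lastDeep h] = 0) := by rw [← hpiv]; omega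
  rw [hdrop, List.filter_cons_of_neg (by simpa using hnot)]
  conv_rhs => rw [← List.take_append_drop (lastDeep h + 1) h]
  rw [List.filter_append, List.length_append]

/-- **Weight comparison**: `rwt(h) ≤ x⁻³ · tWt(RB₁) · tWt(RB₃)` (exactly three extra vertices). [cite: DuminilCopinSmirnov2012, §3] -/
theorem rwt_le_tWt (hh : h ∈ (rotHpLists T L).image hdR) (h1 : 1 ≤ dOf h) {x y : ℝ} (hx0 : 0 < x) :
    rwt x y h ≤ x⁻¹ ^ 3 * (tWt (hOf h) x y (RB1 h) * tWt (hOf h) x y (RB3 h)) := by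
  have hlen := length_RB1_add_RB3 hh
  have htop := topCount_RB1_add_RB3 hh h1
  set t1 := ((RB1 h).filter fun v => xi v = -(hOf h : ℤ)).length
  set t3 := ((RB3 h).filter fun v => xi v = -(hOf h : ℤ)).length
  rw [rwt, tWt, tWt]
  have ey : y ^ t1 * y ^ t3 = y ^ surfCount h := by rw [← pow_add, htop]
  have e1 : x ^ 3 * x⁻¹ ^ 3 = 1 := by rw [← mul_pow, mul_inv_cancel₀ hx0.ne', one_pow]
  have hx : x ^ h.length = x⁻¹ ^ 3 * (x ^ (RB1 h).length * x ^ (RB3 h).length) := by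
    rw [← pow_add, hlen, pow_add]
    calc x ^ h.length = x ^ h.length * (x ^ 3 * x⁻¹ ^ 3) := by rw [e1, mul_one]
      _ = x⁻¹ ^ 3 * (x ^ h.length * x ^ 3) := by ring
  apply le_of_eq
  calc x ^ h.length * y ^ surfCount h = x⁻¹ ^ 3 * (x ^ (RB1 h).length * x ^ (RB3 h).length) * y ^ surfCount h := by rw [hx]
    _ = x⁻¹ ^ 3 * (x ^ (RB1 h).length * y ^ t1 * (x ^ (RB3 h).length * y ^ t3)) := by rw [← ey]; ring

/-- **Injectivity per class**: on heads of depth `≥ 1` and a fixed class `(H', type)` the map `h ↦ (RB₁ h, RB₃ h)` is injective (the pivot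
abscissa is read off `RB₁`'s last vertex `P(a⁺)`; then un-reflect and re-glue at the pivot). [cite: DuminilCopinSmirnov2012, §3 (the decomposition is reversible)] -/
theorem RB_inj {h₁ h₂ : List HV} (hh₁ : h₁ ∈ (rotHpLists T L).image hdR) (hh₂ : h₂ ∈ (rotHpLists T L).image hdR)
    (hcls : clsR h₁ = clsR h₂) (e1 : RB1 h₁ = RB1 h₂) (e3 : RB3 h₁ = RB3 h₂) : h₁ = h₂ := by
  obtain ⟨-, hh0₁, -, -, hne₁, -⟩ := of_mem_headsR hh₁
  obtain ⟨-, hh0₂, -, -, hne₂, -⟩ := of_mem_headsR hh₂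
  obtain ⟨hq₁, -⟩ := pivR_facts hh₁
  obtain ⟨hq₂, -⟩ := pivR_facts hh₂
  rw [clsR, clsR, Prod.mk.injEq] at hcls
  have ht : hOf h₁ = hOf h₂ := hcls.1
  have hc : (pivR h₁).2.2 = (pivR h₂).2.2 := hcls.2
  rw [RB1, RB1] at e1
  rw [RB3, RB3] at e3
  have e1' := (List.cons_injective (a := hvOrigin)) e1
  have e3' := (List.cons_injective (a := hvOrigin)) e3
  have gl : ∀ {g : List HV} (hg0 : g.head? = some hvOrigin) (hq : lastDeep g < g.length),
      (((g.take (lastDeep g + 1)).reverse).map (phR g)).getLast? = some (phR g hvOrigin) := by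
    intro g hg0 hq
    rw [List.getLast?_map, List.getLast?_reverse, List.head?_take, if_neg (by omega), hg0, Option.map_some]
  have hp : (pivR h₁).1 = (pivR h₂).1 := by
    have := congrArg List.getLast? e1'
    rw [gl hh0₁ hq₁, gl hh0₂ hq₂, Option.some_inj, phR, phR, ht, hc] at this
    exact (pmap_hvOrigin_inj _ this).2
  have hsig : phR h₁ = phR h₂ := by rw [phR, phR, ht, hp, hc]
  rw [hsig] at e1' e3'
  have t₁ := List.reverse_inj.1 ((List.map_injective_iff.2 (phR h₂).injective) e1')
  have d₁ := (List.map_injective_iff.2 (phR h₂).injective) e3'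
  calc h₁ = h₁.take (lastDeep h₁ + 1) ++ h₁.drop (lastDeep h₁ + 1) := (List.take_append_drop _ _).symm
    _ = h₁.take (lastDeep h₁ + 1) ++ (h₁.drop (lastDeep h₁)).tail := by rw [List.tail_drop]
    _ = h₂.take (lastDeep h₂ + 1) ++ (h₂.drop (lastDeep h₂)).tail := by rw [t₁, d₁]
    _ = h₂ := by rw [List.tail_drop, List.take_append_drop]

/-- `Σ_{top lists} tWt = B_{H',W'}(x; y)`. [cite: Beaton2014RotatedHoneycomb, §2.4] -/
theorem sum_tWt_eq {H' W' : ℕ} (hH' : 1 ≤ H') (x y : ℝ) :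
    ∑ B ∈ rotTopLists H' W', tWt H' x y B = rotStripGFxy H' W' (IsRotTopDart H') x y := (rotStripGFxy_top_eq hH' x y).symm

/-- **The class sum**: heads of depth `≥ 1` and class `(H', e)` weigh at most `x⁻³ B_{H',W'}(x; y)² ≤ x⁻³ b(H')²`.
[cite: DuminilCopinSmirnov2012, §3 (A_{T+1} − A_T ≤ x B_{T+1}²); Beaton2014RotatedHoneycomb, §3.2] -/
theorem sum_classR_le {x y : ℝ} (hx0 : 0 < x) (hy : 0 ≤ y) (b : ℕ → ℝ)
    (hb : ∀ H' W' : ℕ, 1 ≤ H' → rotStripGFxy H' W' (IsRotTopDart H') x y ≤ b H') (c : ℕ × Bool) :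
    ∑ h ∈ ((rotHpLists T L).image hdR).filter (fun h => 1 ≤ dOf h ∧ clsR h = c), rwt x y h
      ≤ x⁻¹ ^ 3 * (b c.1 * b c.1) := by
  classical
  obtain ⟨W, hW⟩ : ∃ W : ℕ, wOf T L = W := ⟨_, rfl⟩
  set S := ((rotHpLists T L).image hdR).filter (fun h => 1 ≤ dOf h ∧ clsR h = c) with hS
  set bL := rotTopLists c.1 W with hbL
  have hx3 : 0 ≤ x⁻¹ ^ 3 := pow_nonneg (inv_nonneg.2 hx0.le) _
  rcases S.eq_empty_or_nonempty with hSe | ⟨h₀, hh₀⟩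
  · rw [hSe, sum_empty]; exact mul_nonneg hx3 (mul_self_nonneg _)
  obtain ⟨hh₀', h1₀, hc₀⟩ := mem_filter.1 hh₀
  have hT' : 1 ≤ c.1 := by rw [← hc₀]; exact one_le_hOf h₀
  have hmemS : ∀ h ∈ S, h ∈ (rotHpLists T L).image hdR ∧ 1 ≤ dOf h ∧ hOf h = c.1 ∧ clsR h = c := by
    intro h hh
    obtain ⟨hh', h1, hc⟩ := mem_filter.1 hh
    exact ⟨hh', h1, by rw [← hc]; rfl, hc⟩
  set g : List HV × List HV → ℝ := fun uv => tWt c.1 x y uv.1 * tWt c.1 x y uv.2 with hg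
  calc ∑ h ∈ S, rwt x y h
      ≤ ∑ h ∈ S, x⁻¹ ^ 3 * g (RB1 h, RB3 h) := by
        refine sum_le_sum fun h hh => ?_
        obtain ⟨hh', h1, ht, -⟩ := hmemS h hh
        have := rwt_le_tWt (y := y) hh' h1 hx0
        rw [ht] at this
        exact this
    _ = x⁻¹ ^ 3 * ∑ h ∈ S, g (RB1 h, RB3 h) := by rw [mul_sum]
    _ ≤ x⁻¹ ^ 3 * ∑ uv ∈ bL ×ˢ bL, g uv := by
        refine mul_le_mul_of_nonneg_left ?_ hx3
        refine sum_le_sum_of_injOn_of_nonneg (fun h => (RB1 h, RB3 h)) ?_ ?_ g fun uv _ =>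
          mul_nonneg (tWt_nonneg _ hx0.le hy _) (tWt_nonneg _ hx0.le hy _)
        · intro h₁ hh₁ h₂ hh₂ e
          rw [Finset.mem_coe] at hh₁ hh₂
          obtain ⟨hh₁', -, -, hc₁⟩ := hmemS h₁ hh₁
          obtain ⟨hh₂', -, -, hc₂⟩ := hmemS h₂ hh₂
          rw [Prod.mk.injEq] at e
          exact RB_inj hh₁' hh₂' (by rw [hc₁, hc₂]) e.1 e.2
        · intro h hh
          obtain ⟨hh', h1, ht, -⟩ := hmemS h hh
          exact mem_product.2 ⟨RB1_mem hh' h1 ht hW, RB3_mem hh' h1 ht hW⟩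
    _ = x⁻¹ ^ 3 * (rotStripGFxy c.1 W (IsRotTopDart c.1) x y * rotStripGFxy c.1 W (IsRotTopDart c.1) x y) := by
        rw [sum_product, ← sum_tWt_eq hT', sum_mul_sum]
    _ ≤ x⁻¹ ^ 3 * (b c.1 * b c.1) := by
        refine mul_le_mul_of_nonneg_left (mul_self_le_mul_self ?_ (hb _ _ hT')) hx3
        exact rotStripGFxy_nonneg _ _ _ hx0.le hy

/-- **Step C**: `Σ_{heads} rwt ≤ x y + x² y² + 2 x⁻³ Σ_{H'=2}^{T+1} b(H')²` — the depth-`0` heads `[a⁺]`, `[a⁺, a⁻]` weigh `xy`, `x²y²`; every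
other head is cut at its last deepest vertex into two top lists of some `D(H')`, `2 ≤ H' ≤ T + 1`, two type classes per `H'`.
[cite: DuminilCopinSmirnov2012, §3; Beaton2014RotatedHoneycomb, §3.1–3.2] -/
theorem sum_headsR_le {x y : ℝ} (hx0 : 0 < x) (hy : 0 ≤ y) (b : ℕ → ℝ)
    (hb : ∀ H' W' : ℕ, 1 ≤ H' → rotStripGFxy H' W' (IsRotTopDart H') x y ≤ b H') :
    ∑ h ∈ (rotHpLists T L).image hdR, rwt x y h ≤ x * y + x ^ 2 * y ^ 2 + 2 * x⁻¹ ^ 3 * ∑ H' ∈ Icc 2 (T + 1), b H' * b H' := by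
  classical
  set Hs := (rotHpLists T L).image hdR with hHs
  rw [← sum_filter_add_sum_filter_not Hs (fun h => 1 ≤ dOf h)]
  have h1 : ∑ h ∈ Hs.filter (fun h => ¬ 1 ≤ dOf h), rwt x y h ≤ x * y + x ^ 2 * y ^ 2 := by
    have hsub : Hs.filter (fun h => ¬ 1 ≤ dOf h) ⊆ {[hvOrigin], [hvOrigin, wOut]} := by
      intro h hh
      obtain ⟨hh', hlt⟩ := mem_filter.1 hh
      rw [mem_insert, mem_singleton]
      exact eq_of_dOf_eq_zero hh' (by omega)
    refine (sum_le_sum_of_subset_of_nonneg hsub fun h _ _ => rwt_nonneg hx0.le hy h).trans ?_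
    have s1 : surfCount [hvOrigin] = 1 := by simp [surfCount, xi_hvOrigin]
    have s2 : surfCount [hvOrigin, wOut] = 2 := by simp [surfCount, xi_hvOrigin, xi_wOut]
    rw [sum_pair (by simp), rwt, rwt, s1, s2]
    simp only [List.length_cons, List.length_nil, zero_add, Nat.reduceAdd, pow_one, le_refl]
  have h2 : ∑ h ∈ Hs.filter (fun h => 1 ≤ dOf h), rwt x y h ≤ 2 * x⁻¹ ^ 3 * ∑ H' ∈ Icc 2 (T + 1), b H' * b H' := by
    have hmaps : ∀ h ∈ Hs.filter (fun h => 1 ≤ dOf h), clsR h ∈ Icc 2 (T + 1) ×ˢ (univ : Finset Bool) := by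
      intro h hh
      obtain ⟨hh', h1⟩ := mem_filter.1 hh
      obtain ⟨-, -, -, -, -, -, hDT⟩ := pivR_facts hh'
      rw [mem_product, mem_Icc, clsR, hOf]
      exact ⟨⟨by omega, by omega⟩, mem_univ _⟩
    rw [← sum_fiberwise_of_maps_to hmaps]
    calc ∑ c ∈ Icc 2 (T + 1) ×ˢ (univ : Finset Bool), ∑ h ∈ (Hs.filter fun h => 1 ≤ dOf h) with clsR h = c, rwt x y h
        ≤ ∑ c ∈ Icc 2 (T + 1) ×ˢ (univ : Finset Bool), x⁻¹ ^ 3 * (b c.1 * b c.1) := by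
          refine sum_le_sum fun c _ => ?_
          rw [filter_filter]
          exact sum_classR_le hx0 hy b hb c
      _ = 2 * x⁻¹ ^ 3 * ∑ H' ∈ Icc 2 (T + 1), b H' * b H' := by
          rw [sum_product, mul_sum]
          refine sum_congr rfl fun H' _ => ?_
          simp only [Fintype.sum_bool]
          ring
  linarith

end RCutD

/-- **D1ʳ `RotHalfPlaneCut` HOLDS** (the rotated two-cut): `C^+_{T,L}(x,y) ≤ (1 + x Z)(x y + x² y² + 2 x⁻³ Σ_{H'=2}^{T+1} b(H')²)`.
[cite: Beaton2014RotatedHoneycomb, §4, proof of Proposition 11 (arXiv v3 p. 18: "can be factored into two pieces by cutting it at the mid-edge immediately following its last surface contact", Fig. 7); Beaton2014RotatedHoneycomb, §3.1 (arXiv v3 p. 11) and §4 (p. 16); DuminilCopinSmirnov2012, §3, proof of Theorem 1 (bridge decomposition, arXiv PDF p. 8); HammersleyWelsh1962; MadrasSlade1993, §3.1 (pp. 57–59)] -/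
theorem rotHalfPlaneCut_holds : RotHalfPlaneCut := by
  intro x y hx0 hx1 hy b c z hb hc hz T L
  have hz0 : 0 ≤ z := by simpa using hz 0
  have hB := sum_rotHpLists_le_heads (T := T) (L := L) hx0.le hy c z hc hz
  have hC := sum_headsR_le (T := T) (L := L) hx0 hy b hb
  have h12 : 0 ≤ 1 + x * z := by nlinarith
  rw [rotHpGF_eq_sum_rwt]
  exact hB.trans (mul_le_mul_of_nonneg_left hC h12)

/-- `RotHalfPlaneCut` — `_holds` alias of `rotHalfPlaneCut_holds` above under the fact's exact name (appended
2026-08-28, D-0026 bookkeeping: the proof term is the existing theorem of this file; no statement,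
definition or attribute is edited; no new named fact; the ledger's debt table listed the fact
unproved). [cite: Beaton2014RotatedHoneycomb, §4, proof of Proposition 11 (arXiv v3 p. 18: "can be factored into two pieces by cutting it at the mid-edge immediately following its last surface contact", Fig. 7); Beaton2014RotatedHoneycomb, §3.1 (arXiv v3 p. 11) and §4 (p. 16); DuminilCopinSmirnov2012, §3, proof of Theorem 1 (bridge decomposition, arXiv PDF p. 8); HammersleyWelsh1962; MadrasSlade1993, §3.1 (pp. 57–59)] -/
theorem _root_.Literature.Probability.RandomPlanarGeometry.SAW.HV.RotHalfPlaneCut_holds :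
    RotHalfPlaneCut :=
  _root_.Literature.Probability.RandomPlanarGeometry.SAW.HV.RotYcCut.rotHalfPlaneCut_holds


end RotYcCut

/-- **D1ʳ `RotHalfPlaneCut` HOLDS** (re-export of `RotYcCut.rotHalfPlaneCut_holds` at the level of the vocabulary).
[cite: Beaton2014RotatedHoneycomb, §4, proof of Proposition 11 (arXiv v3 p. 18, Fig. 7: the last-contact cut); DuminilCopinSmirnov2012, §3, proof of Theorem 1 (arXiv PDF p. 8); GlazmanManolescu2019, §5.4 (arXiv v3 pp. 23–24: the DCS-frame twin)] -/
theorem rotHalfPlaneCut_holds : RotHalfPlaneCut := RotYcCut.rotHalfPlaneCut_holds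

end Literature.Probability.RandomPlanarGeometry.SAW.HV
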